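import Mathlib
import Literature.Barriers.PneNP.TSPExtensionComplexity
import Literature.Barriers.PneNP.ExtendedFormulationLinearImage

/-!
# GENERIC VIRTUAL HARDNESS (val-idea-40 g7, lens «Minkowski-summand structure — which Q survive»)

Crux `FifoMatching.NNDivisionHard` (stmt-ValiantsHypothesis-21181); research stub of the line of record
`Lines/virtual_passenger.lean` REV 24 = `CoreLawHull` ⟺ `CorVirtualHard` = "the VIRTUAL extension complexity
`vxc(COR(K_h))` is super-quasi-polynomial" (Hertrich–Loho, arXiv:2411.03006v4, Question 5.1 at COR).

This file is KERNEL GLUE for the law-level statement that the phenomenon the stub asserts — a polytope `P`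
all of whose Minkowski co-summands `(Q, P + Q)` are expensive — is GENERIC among 0/1 polytopes:

* `VxcLe P r` — the passenger currency of the line (`q : Fin (K+1) → ℝ^ι`, `HasEFOfSize (conv q) r`,
  `HasEFOfSize (P + conv q) r`), for an arbitrary `P`.
* `VxcLe.image_linearMap`, `VxcLe.mono` — virtual EFs are monotone under linear images and in the size
  (faces: `HasEFOfSize.face_add_face`, tree), i.e. `vxc` is monotone under Maksimenko's `≤_E`.
* `mem_of_add_subset_add` — CANCELLATION: `z + Q ⊆ P + Q`, `P` closed convex, `Q` compact nonempty ⇒ `z ∈ P`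
  (Hahn–Banach + a maximiser of the separating functional on `Q`).
* `mem_of_emb_mem_convexHull` — a 0/1 point of `conv X`, `X ⊆ {0,1}^n`, lies in `X`.
* `pattern` / `pattern_eq` — the CONTAINMENT PATTERN `{z ∈ {0,1}^n | z + projSet Q₁ ⊆ projSet Q₂}` of a pair of
  slack-form systems; for a genuine virtual EF of `conv X` it equals `X`.
* `exists_not_vxcLe_of_ncard_lt` — COUNTING CORE: if the pairs of size-`r` systems realise fewer than `2^(2^n)`
  patterns, some `X ⊆ {0,1}^n` has `¬ VxcLe (conv X) r`.
* `PatternBoundPoly` — the ONE named analytic input (paper: Basu–Pollack–Roy, *Algorithms in Real Algebraic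
  Geometry*, Thm 14.16 (two-block quantifier elimination, singly exponential) + Prop 7.31 (Warren / Pollack–Roy
  count of realisable sign conditions)): the number of patterns is `≤ 2^(C·(n+r+2)^d)`.
* `generic_virtual_hardness` — `PatternBoundPoly → ∃ a > 0, ∃ n₀, ∀ n ≥ n₀, ∃ X ⊆ {0,1}^n, ∀ r ≤ 2^(n/a),
  ¬ VxcLe (conv X) r`.

No `sorry`, no new axiom; the semialgebraic count is a HYPOTHESIS, proved on paper in the companion memo
`GenericVirtualHardness40.md` (which also records the hub proposition `CorVirtualHard ⟺ explicit virtual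
hardness` and the literature placement).  Nothing here is distance on 21181; VP ≠ VNP is NOT proved.

LABEL (binding; director R358 (3), critic V#141b (iv)): FRONTIER-GRADE COUNTING CALIBRATION of the currency
`vxc` (random, NON-explicit 0/1 polytopes).  It says NOTHING about `COR(K_h)` or any explicit family and moves
0 distance on 21181 / C′; «generic» is not evidence for C′.
-/

noncomputable section

set_option autoImplicit false
set_option linter.dupNamespace false

open scoped Pointwise
open Literature.Barriers.PneNP

namespace Summit.ValiantsHypothesis.ValiantsHypothesis.Cruxes.NNDivisionHard.GenericVirtualHardness40

variable {ι : Type} [Fintype ι]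

/-! ## 1. The passenger currency for an arbitrary polytope -/

/-- **`P` has a virtual extended formulation of size `r`** in the line's passenger currency: some V-polytope
`Q = conv(q₀,…,q_K)` has `xc(Q) ≤ r` and `xc(P + Q) ≤ r` (slack-form `HasEFOfSize`).  For `P = COR(K_h)` and
`r = T c h` this is the matrix of `CorVirtualHard`. -/
def VxcLe (P : Set (ι → ℝ)) (r : ℕ) : Prop :=
  ∃ (K : ℕ) (q : Fin (K + 1) → (ι → ℝ)),
    HasEFOfSize (convexHull ℝ (Set.range q)) r ∧ HasEFOfSize (P + convexHull ℝ (Set.range q)) r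

theorem VxcLe.mono {P : Set (ι → ℝ)} {r r' : ℕ} (h : VxcLe P r) (hle : r ≤ r') : VxcLe P r' := by
  obtain ⟨K, q, h1, h2⟩ := h
  exact ⟨K, q, h1.of_le hle, h2.of_le hle⟩

/-- **virtual EFs pass to linear images with no loss** (`vxc(L P) ≤ vxc(P)`): the passenger travels along. -/
theorem VxcLe.image_linearMap {P : Set (ι → ℝ)} {r : ℕ} (h : VxcLe P r) {κ : Type} [Fintype κ]
    (L : (ι → ℝ) →ₗ[ℝ] (κ → ℝ)) : VxcLe (L '' P) r := by
  obtain ⟨K, q, h1, h2⟩ := h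
  refine ⟨K, L ∘ q, ?_, ?_⟩
  · rw [Set.range_comp, ← LinearMap.image_convexHull]
    exact h1.image_linearMap L
  · rw [Set.range_comp, ← LinearMap.image_convexHull, ← Set.image_add]
    exact h2.image_linearMap L

/-! ## 2. Cancellation and 0/1 points -/

/-- **CANCELLATION** (the half of `(P + Q) ∸ Q = P` that needs convexity): if `z + Q ⊆ P + Q` with `P` closed
convex and `Q` compact nonempty then `z ∈ P`.  [Schneider, *Convex Bodies*, §3.1; Hertrich–Loho §4.3 p. 16
"the cancellation property"] -/
theorem mem_of_add_subset_add {E : Type*} [NormedAddCommGroup E] [NormedSpace ℝ E] {P Q : Set E}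
    (hPc : Convex ℝ P) (hPcl : IsClosed P) (hQc : IsCompact Q) (hQne : Q.Nonempty) {z : E}
    (h : ∀ x ∈ Q, z + x ∈ P + Q) : z ∈ P := by
  by_contra hz
  obtain ⟨f, u, hfP, hfz⟩ := geometric_hahn_banach_closed_point hPc hPcl hz
  obtain ⟨x₀, hx₀, hmax⟩ := hQc.exists_isMaxOn hQne f.continuous.continuousOn
  obtain ⟨p, hp, q, hq, hpq⟩ := Set.mem_add.mp (h x₀ hx₀)
  have h1 : f p < u := hfP p hp
  have h2 : f q ≤ f x₀ := hmax hq
  have h3 : f p + f q = f z + f x₀ := by rw [← map_add, ← map_add, hpq]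
  linarith

/-- the 0/1 embedding `{0,1}^n ↪ ℝ^n`. -/
def emb {n : ℕ} (z : Fin n → Bool) : Fin n → ℝ := fun i => if z i then 1 else 0

theorem emb_injective {n : ℕ} : Function.Injective (emb (n := n)) := by
  intro z z' h
  funext i
  have := congrFun h i
  by_cases hz : z i <;> by_cases hz' : z' i <;> simp_all [emb]

/-- **a 0/1 point of `conv X` (`X ⊆ {0,1}^n`) lies in `X`** (0/1 points are vertices of the cube: the functional
`x ↦ Σ_{z_i=1} x_i − Σ_{z_i=0} x_i` is `< |z|` on every 0/1 point other than `z`). -/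
theorem mem_of_emb_mem_convexHull {n : ℕ} {X : Set (Fin n → Bool)} {z : Fin n → Bool}
    (h : emb z ∈ convexHull ℝ (emb '' X)) : z ∈ X := by
  classical
  by_contra hz
  -- the separating functional
  let φ : (Fin n → ℝ) → ℝ := fun x => ∑ i, (if z i then x i else -x i)
  have hφ : IsLinearMap ℝ φ := by
    refine ⟨fun x y => ?_, fun c x => ?_⟩
    · simp only [φ, Pi.add_apply, ← Finset.sum_add_distrib]
      refine Finset.sum_congr rfl fun i _ => ?_
      split_ifs <;> ring
    · simp only [φ, Pi.smul_apply, smul_eq_mul, Finset.mul_sum]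
      refine Finset.sum_congr rfl fun i _ => ?_
      split_ifs <;> ring
  -- every point of `X` is on the far side of the hyperplane `φ = φ (emb z) - 1`
  have hX : emb '' X ⊆ {x | φ x ≤ φ (emb z) - 1} := by
    rintro _ ⟨x, hx, rfl⟩
    have hne : x ≠ z := fun hxz => hz (hxz ▸ hx)
    obtain ⟨i₀, hi₀⟩ : ∃ i, x i ≠ z i := Function.ne_iff.mp hne
    -- termwise comparison, strict at `i₀`
    have hterm : ∀ i, (if z i then emb x i else -emb x i) ≤ (if z i then emb z i else -emb z i) := by
      intro i
      by_cases hzi : z i <;> by_cases hxi : x i <;> simp [emb, hzi, hxi]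
    have hterm₀ : (if z i₀ then emb x i₀ else -emb x i₀) ≤ (if z i₀ then emb z i₀ else -emb z i₀) - 1 := by
      by_cases hzi : z i₀ <;> by_cases hxi : x i₀ <;> simp_all [emb]
    show φ (emb x) ≤ φ (emb z) - 1
    simp only [φ]
    rw [← Finset.add_sum_erase _ _ (Finset.mem_univ i₀), ← Finset.add_sum_erase _ _ (Finset.mem_univ i₀)]
    have hrest : ∑ i ∈ Finset.univ.erase i₀, (if z i then emb x i else -emb x i)
        ≤ ∑ i ∈ Finset.univ.erase i₀, (if z i then emb z i else -emb z i) :=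
      Finset.sum_le_sum fun i _ => hterm i
    linarith
  have hconv : Convex ℝ {x : Fin n → ℝ | φ x ≤ φ (emb z) - 1} := convex_halfSpace_le hφ _
  have := (convexHull_min hX hconv) h
  simp only [Set.mem_setOf_eq] at this
  linarith

/-! ## 3. The containment pattern of a pair of slack-form systems -/

/-- **containment pattern**: the 0/1 points `z` with `z + projSet Q₁ ⊆ projSet Q₂`.  As the real entries of
`(Q₁, Q₂)` vary (with `k ≤ n + r + 1` rows WLOG) this is a first-order-definable family over `ℝ` with two
quantifier blocks; its number of distinct members is what `PatternBoundPoly` bounds. -/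
def pattern (n r : ℕ) (Q : ExtendedFormulation (Fin n) r × ExtendedFormulation (Fin n) r) :
    Set (Fin n → Bool) :=
  {z | ∀ x ∈ Q.1.projSet, emb z + x ∈ Q.2.projSet}

/-- **for a genuine virtual EF of `conv X` the pattern is `X`** (cancellation + 0/1 points are vertices). -/
theorem pattern_eq {n r K : ℕ} (X : Set (Fin n → Bool)) (q : Fin (K + 1) → (Fin n → ℝ))
    (Q₁ Q₂ : ExtendedFormulation (Fin n) r) (h₁ : Q₁.projSet = convexHull ℝ (Set.range q))
    (h₂ : Q₂.projSet = convexHull ℝ (emb '' X) + convexHull ℝ (Set.range q)) :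
    pattern n r (Q₁, Q₂) = X := by
  ext z
  simp only [pattern, Set.mem_setOf_eq, h₁, h₂]
  constructor
  · intro hz
    have hQc : IsCompact (convexHull ℝ (Set.range q)) := (Set.finite_range q).isCompact_convexHull (𝕜 := ℝ)
    have hQne : (convexHull ℝ (Set.range q)).Nonempty := ⟨q 0, subset_convexHull ℝ _ ⟨0, rfl⟩⟩
    have hPcl : IsClosed (convexHull ℝ (emb '' X)) := (X.toFinite.image emb).isClosed_convexHull (𝕜 := ℝ)
    exact mem_of_emb_mem_convexHull
      (mem_of_add_subset_add (convex_convexHull ℝ _) hPcl hQc hQne hz)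
  · intro hz x hx
    exact Set.add_mem_add (subset_convexHull ℝ _ ⟨z, hz, rfl⟩) hx

/-! ## 4. Counting core -/

/-- the patterns form a finite family (a set of subsets of the finite cube). -/
theorem finite_range_pattern (n r : ℕ) : (Set.range (pattern n r)).Finite := Set.toFinite _

theorem ncard_univ_set_cube (n : ℕ) : (Set.univ : Set (Set (Fin n → Bool))).ncard = 2 ^ 2 ^ n := by
  classical
  rw [Set.ncard_univ, Nat.card_eq_fintype_card, Fintype.card_set, Fintype.card_fun, Fintype.card_bool,
    Fintype.card_fin]

/-- **COUNTING CORE.**  If the pairs of size-`r` slack-form systems over `ℝ^n` realise fewer than `2^(2^n)`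
containment patterns, then some `X ⊆ {0,1}^n` has NO virtual EF of size `r` (in the passenger currency). -/
theorem exists_not_vxcLe_of_ncard_lt {n r : ℕ} (h : (Set.range (pattern n r)).ncard < 2 ^ 2 ^ n) :
    ∃ X : Set (Fin n → Bool), ¬ VxcLe (convexHull ℝ (emb '' X)) r := by
  classical
  have hne : Set.range (pattern n r) ≠ Set.univ := by
    intro hu
    rw [hu, ncard_univ_set_cube] at h
    exact lt_irrefl _ h
  obtain ⟨X, hX⟩ := (Set.ne_univ_iff_exists_notMem _).mp hne
  refine ⟨X, fun hv => hX ?_⟩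
  obtain ⟨K, q, ⟨Q₁, hQ₁⟩, ⟨Q₂, hQ₂⟩⟩ := hv
  exact ⟨(Q₁, Q₂), pattern_eq X q Q₁ Q₂ hQ₁ hQ₂⟩

/-! ## 5. The named analytic input and the asymptotic statement -/

/-- **PATTERN BOUND** (the ONE hypothesis; paper proof in `GenericVirtualHardness40.md` §2: reduce to
`k ≤ n + r + 1` rows, write `z + projSet Q₁ ⊆ projSet Q₂` as a `∀∃` formula with `2(n+2r+1)` atoms of degree
`≤ 2` in `N = 2(n+r+1)(n+r+2)` real parameters, eliminate quantifiers [Basu–Pollack–Roy Thm 14.16], and count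
realisable sign conditions of the resulting `2^n · M` polynomials in `ℝ^N` [ibid. Prop 7.31]). -/
def PatternBoundPoly : Prop :=
  ∃ C d : ℕ, ∀ n r : ℕ, (Set.range (pattern n r)).ncard ≤ 2 ^ (C * (n + r + 2) ^ d)

/-- elementary growth lemma: `C · (n + 2^(n/a) + 2)^d < 2^n` for `a = 2(d+1)` and `n ≥ a · (C · (a+3)^d + 1)`. -/
theorem growth_bound (C d : ℕ) :
    ∃ a : ℕ, 0 < a ∧ ∃ n₀ : ℕ, ∀ n ≥ n₀, C * (n + 2 ^ (n / a) + 2) ^ d < 2 ^ n := by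
  set a := 2 * (d + 1) with ha
  have ha0 : 0 < a := by omega
  refine ⟨a, ha0, a * (C * (a + 3) ^ d + 1), fun n hn => ?_⟩
  set m := n / a with hm
  -- `m ≥ C (a+3)^d + 1`, hence `C (a+3)^d < 2^m`
  have hm0 : C * (a + 3) ^ d + 1 ≤ m := by
    rw [hm]; exact (Nat.le_div_iff_mul_le ha0).mpr (by simpa [mul_comm] using hn)
  have h2m : C * (a + 3) ^ d < 2 ^ m := lt_of_lt_of_le (lt_of_lt_of_le (Nat.lt_succ_self _) hm0) (Nat.lt_two_pow_self).le
  -- `n + 2^m + 2 ≤ (a+3) 2^m`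
  have hn_lt : n < a * (m + 1) := by
    rw [hm]; exact Nat.lt_mul_div_succ n ha0
  have hm1 : m + 1 ≤ 2 ^ m := Nat.lt_two_pow_self
  have hbase : n + 2 ^ m + 2 ≤ (a + 3) * 2 ^ m := by nlinarith
  -- so `C (n + 2^m + 2)^d ≤ C (a+3)^d 2^(d m) < 2^m 2^(d m) = 2^((d+1) m) ≤ 2^n`
  have hpow : (n + 2 ^ m + 2) ^ d ≤ (a + 3) ^ d * 2 ^ (d * m) := by
    calc (n + 2 ^ m + 2) ^ d ≤ ((a + 3) * 2 ^ m) ^ d := Nat.pow_le_pow_left hbase d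
      _ = (a + 3) ^ d * 2 ^ (d * m) := by rw [mul_pow, ← pow_mul, mul_comm m d]
  have hdm : (d + 1) * m ≤ n := by
    have : a * m ≤ n := by rw [hm]; exact Nat.mul_div_le n a
    nlinarith
  calc C * (n + 2 ^ m + 2) ^ d ≤ C * ((a + 3) ^ d * 2 ^ (d * m)) := Nat.mul_le_mul_left C hpow
    _ = (C * (a + 3) ^ d) * 2 ^ (d * m) := by ring
    _ < 2 ^ m * 2 ^ (d * m) := Nat.mul_lt_mul_of_pos_right h2m (by positivity)
    _ = 2 ^ ((d + 1) * m) := by rw [← pow_add]; ring_nf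
    _ ≤ 2 ^ n := Nat.pow_le_pow_right (by norm_num) hdm

/-- **GENERIC VIRTUAL HARDNESS** (modulo the semialgebraic pattern count): there are `a > 0` and `n₀` such that
for every `n ≥ n₀` some 0/1 polytope `conv X ⊆ ℝ^n` has NO virtual extended formulation of size `≤ 2^(n/a)` —
no passenger `Q = conv(q)` with `xc(Q) ≤ 2^(n/a)` makes `xc(conv X + Q) ≤ 2^(n/a)`.  (The memo's paper count
gives this for all but a `2^{-2^{n-1}}` fraction of the `X`, and for almost all matroid base polytopes.) -/
theorem generic_virtual_hardness (hPB : PatternBoundPoly) :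
    ∃ a : ℕ, 0 < a ∧ ∃ n₀ : ℕ, ∀ n ≥ n₀, ∃ X : Set (Fin n → Bool),
      ∀ r : ℕ, r ≤ 2 ^ (n / a) → ¬ VxcLe (convexHull ℝ (emb '' X)) r := by
  obtain ⟨C, d, hCd⟩ := hPB
  obtain ⟨a, ha, n₀, hgrow⟩ := growth_bound C d
  refine ⟨a, ha, n₀, fun n hn => ?_⟩
  -- at the top size `R = 2^(n/a)` there are too few patterns
  have hlt : (Set.range (pattern n (2 ^ (n / a)))).ncard < 2 ^ 2 ^ n :=
    lt_of_le_of_lt (hCd n _) (Nat.pow_lt_pow_right (by norm_num) (hgrow n hn))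
  obtain ⟨X, hX⟩ := exists_not_vxcLe_of_ncard_lt hlt
  exact ⟨X, fun r hr hv => hX (hv.mono hr)⟩

end Summit.ValiantsHypothesis.ValiantsHypothesis.Cruxes.NNDivisionHard.GenericVirtualHardness40
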